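import Summits.QuantumFields.YangMills.Theorems.BalabanUVNodesN15KingModelLimit
import Literature.MathematicalPhysics.QuantumFieldTheory.Balaban1983to89.NodeOGamma0Road

/-!
# Route «BalabanUVNodes» (K4 «SpineRates»), node N15 = NE2 — THE KING-MODEL RUNG, part 5: THE CONTINUUM-LIMIT EFFECTIVE THEORY AS AN OBJECT —
# `Δ^{(∞)} = lim Δ^{(k)}`, `Δ^{(∞)} + aL⁻²Q*Q` coercive and positive definite, `C^{(∞)} = (Δ^{(∞)} + aL⁻²Q*Q)⁻¹ = lim C^{(k)}` AS MATRICES,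
# its exponential decay, and the DECAY-KEEPING tail `|C^{(k)} − C^{(∞)}|(x, y) ≤ K₄₅L^{−k}e^{−δ₄₅|x−y|_T}` (King's (4.38) at `n = ∞`)

Cell `pub-ymgap`, Track A (D-0062), seat `pub-ymgap-dag-n15-d` (R134 seat, strategy s3 «King 1986 Lemma 4.5 (4.38) as the scalar kernel», gen 3).
`bears_on: R4∕N15`; `--supports stmt-QuantumFields-19676` (K3).  COUNT-NEUTRAL; two limit objects are data (`limUnder`), every theorem by name.

THE PRINT.  [King1986] = C. King, CMP **102** (1986) 649–677, §4 pp. 670–676: the `k → ∞` (`ε = L^{−k} → 0`) limit of the unit-lattice effective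
theory of the `A = 0` model EXISTS — Lemma 4.3 (4.18) p. 672 (the effective Laplacians `Δ^{(k)}` converge, rate `L^{−2k}`), Lemma 4.5 (4.38) p. 674
(the covariances `C^{(k)} = (Δ^{(k)} + aL⁻²Q*Q)⁻¹` converge, rate `L^{−k}`, UNIFORMLY IN `n`, with the decay `e^{−δ₀|x−y|}`), (4.33)–(4.34) (uniform
non-degeneracy and decay).  Part 4 recorded the limit of each ENTRY `C^{(k)}(x, y)` as a real number with the socket's decay-free tail; this part
records what §4 delivers: the LIMIT THEORY as an object.

CONTENTS (0 sorry).  §1 GENERIC, in the socket's currency (`Spine.NE2KingTransplant`: any finite index set, tower `k ↦ D k`, block term `B`):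
`tower_entry_limit` ∕ `tower_limit` ((H3), `r < 1` ⇒ `D k → D^∞` entrywise, tail `εr^k∕(1−r)`); `covariance_entry_limit_decay` (ROOT ⇒ the inverses
converge with the DECAY-KEEPING tail `C·e^{−κ′d(x,y)}·s^k∕(1−s)`); `limit_mul_eq_one` (`(D k + B)(D k + B)⁻¹ = 1` passes to the limit);
`coercive_of_tendsto` ((H1) is closed under entrywise limits; then `NodeOGamma0Road.posDef_of_coercive_symm`); `inv_entry_decay_of_leaves` ((H1)+(H2) ⇒ `|(D k + B)⁻¹(x,y)| ≤
(γ−ρ−ρ_B)⁻¹e^{−κd}` at EVERY level, `King1986.covOp_decay`); the package **`continuumLimit_of_leaves`** — the five leaves with `r < 1`, `γ > 0` give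
`D^∞`, `C^∞` with `D k → D^∞`, `Coercive (D^∞ + B) γ`, `(D^∞ + B)·C^∞ = 1`, `C^∞ = (D^∞ + B)⁻¹`, `(D k + B)⁻¹ → C^∞`, the decay of `C^∞` and the
decay-keeping tail: THE PAY-OFF of part 3's checklist for ANY tower inhabiting the socket (the curved case included).
§2 KING'S MODEL BY NAME (every torus `Π_μ ℤ∕(LM_μ)`, `L ≥ 2`, `a, m² > 0`): `kingLevelLim = Δ^{(∞)}`, `kingCovLim = C^{(∞)}` (entrywise `limUnder`);
**`kingLevel_tendsto`** (tail `θ̄a·L^{−2k}∕(1−L⁻²)`); **`coercive_kingLevelLim_add_block`** ((4.33) for the limit, `γ₀ = gam0L`) and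
**`posDef_kingLevelLim_add_block`**; **`kingCov_tendsto_kingCovLim`**; **`kingCovLim_eq_inv`** — `C^{(∞)} = (Δ^{(∞)} + aL⁻²Q*Q)⁻¹`, THE COVARIANCE OF
THE LIMIT THEORY; **`posDef_kingCovLim`**; `kingCov_abs_le` ∕ **`kingCovLim_abs_le`** ((4.34)-decay `(γ₀−ρ−ρ_B)⁻¹e^{−κ′|x−y|_T}` of every `C^{(k)}` and
of `C^{(∞)}`); **`kingCov_sub_kingCovLim_le`** — KING'S (4.38) AT `n = ∞` WITH ITS DECAY, `|C^{(k)} − C^{(∞)}|(x,y) ≤ K₄₅L^{−k}e^{−δ₄₅|x−y|_T}` (`k ≥ 1`;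
from the n-UNIFORM `king_lemma45_torus`, `n → ∞`; no `(1−L⁻¹)⁻¹`); **`king_continuumLimit`** (all at once, `C^{(k)} → C^{(∞)}` AS MATRICES); `_dim4`.

HONEST FRAMING ∕ LIMITS.  King's `A = 0` SCALAR MODEL on a FIXED finite unit torus (the limit removes the fine lattice spacing `ε = L^{−k}` at fixed
unit lattice — one finite-volume continuum limit of a FREE-field block-spin effective theory, [folklore]-level once Lemmas 4.3∕4.5 are in hand);
periodic b.c.; levels `k ≥ 1`; NOT Bałaban's `C^{(k)}(Λ; U)`; NOT the carriers of record (NODE 00); NOT a node discharge; typed 28∕28, discharged count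
untouched; NOT ℝ⁴ ∕ infinite volume ∕ OS ∕ mass gap ∕ Clay.  What the curved case adds is unchanged (part 3's checklist: the five leaves for
`Δ^{(k)}(U)`, `B(U)` uniformly over regular `U`; (H3) at `U` NOT PRINTED = N16's `LocalRate`) — §1's package is what those leaves would then buy.
Locators only: [King1986] Lemma 4.3 (4.18) p. 672, (4.33)–(4.34) p. 674, Lemma 4.5 (4.38) p. 674, §4 pp. 675–676.
-/

noncomputable section

open Matrix Filter Topology

namespace Summit.QuantumFields.YangMills.BalabanUVNodes.N15.KingModel

open Literature.MathematicalPhysics.QuantumFieldTheory.Balaban1983to89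
open Literature.MathematicalPhysics.QuantumFieldTheory.Balaban1983to89.QGQInverse (Coercive isUnit_of_coercive inv_entry_le_of_coercive)
open Literature.MathematicalPhysics.QuantumFieldTheory.Balaban1983to89.B5Prop11Plancherel (Tor fine)
open Literature.MathematicalPhysics.QuantumFieldTheory.Balaban1983to89.T4EtaRateMin (exists_limit_of_geomRate)
open Literature.MathematicalPhysics.QuantumFieldTheory.Balaban1983to89.NodeOGamma0Road (posDef_of_coercive_symm)
open Literature.MathematicalPhysics.QuantumFieldTheory.King1986 (covOp_decay covOp_one)
open Literature.MathematicalPhysics.QuantumFieldTheory.King1986.Torus (effLaplacian effLaplacian_symm blockProj blockOf tdistT tdistT_isPseudoDist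
  gam0L gam0L_pos kapCT kapCT_pos_le thetaBar K45 delta45 delta45_pos king_lemma45_torus)
open Summit.QuantumFields.BalabanUV.T4Continuum.NE2KingTransplant (IsPseudoMetric UniformCoercive UniformCTBound UniformKernelDecay
  EffectiveOperatorSupRate VolumeSum CovarianceTowerRate covarianceTowerRate_of_leaves)

/-! ## §1 Generic: what the socket's leaves buy at `k = ∞` (any finite index set) -/

section Generic

variable {n : Type*} [Fintype n] [DecidableEq n]

omit [Fintype n] [DecidableEq n] in
/-- **(H3) with `r < 1` ⇒ every entry of the tower converges**, with the geometric tail `ε·r^k∕(1 − r)` (King: Lemma 4.3 is a Cauchy estimate for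
`Δ^{(k)}`). [cite: King1986, Lemma 4.3 (4.18) p.672] -/
theorem tower_entry_limit {D : ℕ → Matrix n n ℝ} {ε r : ℝ} (hr1 : r < 1) (h3 : EffectiveOperatorSupRate D ε r) (z w : n) :
    ∃ ℓ : ℝ, Tendsto (fun k => D k z w) atTop (𝓝 ℓ) ∧ ∀ k, |D k z w - ℓ| ≤ ε * r ^ k / (1 - r) :=
  exists_limit_of_geomRate hr1 fun k => by
    have h := h3 k z w
    rwa [Matrix.sub_apply] at h

omit [Fintype n] [DecidableEq n] in
/-- … hence the tower has an entrywise LIMIT MATRIX `D^∞` with that tail. [cite: King1986, Lemma 4.3 (4.18) p.672] -/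
theorem tower_limit {D : ℕ → Matrix n n ℝ} {ε r : ℝ} (hr1 : r < 1) (h3 : EffectiveOperatorSupRate D ε r) :
    ∃ Dinf : Matrix n n ℝ, ∀ z w, Tendsto (fun k => D k z w) atTop (𝓝 (Dinf z w)) ∧ ∀ k, |D k z w - Dinf z w| ≤ ε * r ^ k / (1 - r) := by
  choose ℓ hℓ using tower_entry_limit hr1 h3
  exact ⟨Matrix.of ℓ, fun z w => by rw [Matrix.of_apply]; exact hℓ z w⟩

/-- **ROOT ⇒ the inverses converge entrywise WITH THE DECAY KEPT**: `|(D k + B)⁻¹(x,y) − ℓ| ≤ C·e^{−κ′d(x,y)}·s^k∕(1 − s)` (the one-step rate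
`C·s^k·e^{−κ′d}` is geometric in `k` with constant `C·e^{−κ′d(x,y)}` AT EACH PAIR — part 4's `covariance_entry_limit` used the constant `C`).
[cite: King1986, Lemma 4.5 (4.38) p.674, §4 p.675] -/
theorem covariance_entry_limit_decay {D : ℕ → Matrix n n ℝ} {B : Matrix n n ℝ} {d : n → n → ℝ} {C κ' s : ℝ}
    (hs1 : s < 1) (h : CovarianceTowerRate D B d C κ' s) (x y : n) :
    ∃ ℓ : ℝ, Tendsto (fun k => (D k + B)⁻¹ x y) atTop (𝓝 ℓ) ∧
      ∀ k, |(D k + B)⁻¹ x y - ℓ| ≤ C * Real.exp (-(κ' * d x y)) * s ^ k / (1 - s) :=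
  exists_limit_of_geomRate hs1 fun k => by
    have h0 := h k x y
    rw [abs_sub_comm] at h0
    calc |(D (k + 1) + B)⁻¹ x y - (D k + B)⁻¹ x y| ≤ C * s ^ k * Real.exp (-(κ' * d x y)) := h0
      _ = C * Real.exp (-(κ' * d x y)) * s ^ k := by ring

omit [DecidableEq n] in
/-- Entrywise limits pass through matrix products (finite sums of products). [folklore] -/
theorem tendsto_matrix_mul_apply {A C : ℕ → Matrix n n ℝ} {Ainf Cinf : Matrix n n ℝ}
    (hA : ∀ z w, Tendsto (fun k => A k z w) atTop (𝓝 (Ainf z w))) (hC : ∀ z w, Tendsto (fun k => C k z w) atTop (𝓝 (Cinf z w)))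
    (x y : n) : Tendsto (fun k => (A k * C k) x y) atTop (𝓝 ((Ainf * Cinf) x y)) := by
  simp only [Matrix.mul_apply]
  exact tendsto_finsetSum _ fun z _ => (hA x z).mul (hC z y)

/-- **The right-inverse identity passes to the limit**: `A_k·C_k = 1` for all `k`, `A_k → A^∞`, `C_k → C^∞` entrywise ⇒ `A^∞·C^∞ = 1`. [folklore] -/
theorem limit_mul_eq_one {A C : ℕ → Matrix n n ℝ} {Ainf Cinf : Matrix n n ℝ}
    (hA : ∀ z w, Tendsto (fun k => A k z w) atTop (𝓝 (Ainf z w))) (hC : ∀ z w, Tendsto (fun k => C k z w) atTop (𝓝 (Cinf z w)))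
    (hAC : ∀ k, A k * C k = 1) : Ainf * Cinf = 1 := by
  ext x y
  have h1 : Tendsto (fun k => (A k * C k) x y) atTop (𝓝 ((1 : Matrix n n ℝ) x y)) := by
    simp only [hAC]; exact tendsto_const_nhds
  exact tendsto_nhds_unique (tendsto_matrix_mul_apply hA hC x y) h1

omit [DecidableEq n] in
/-- Quadratic forms pass to entrywise limits. [folklore] -/
theorem tendsto_dotProduct_mulVec {S : ℕ → Matrix n n ℝ} {Sinf : Matrix n n ℝ} (hS : ∀ z w, Tendsto (fun k => S k z w) atTop (𝓝 (Sinf z w)))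
    (v : n → ℝ) : Tendsto (fun k => v ⬝ᵥ (S k *ᵥ v)) atTop (𝓝 (v ⬝ᵥ (Sinf *ᵥ v))) := by
  simp only [dotProduct, Matrix.mulVec]
  exact tendsto_finsetSum _ fun i _ => tendsto_const_nhds.mul (tendsto_finsetSum _ fun j _ => (hS i j).mul tendsto_const_nhds)

omit [DecidableEq n] in
/-- **(H1) is closed under entrywise limits**: uniformly coercive `S_k → S^∞` ⇒ `S^∞` coercive with the same `γ` (King's (4.33) survives `k → ∞`).
[cite: King1986, (4.33) p.674] -/
theorem coercive_of_tendsto {S : ℕ → Matrix n n ℝ} {Sinf : Matrix n n ℝ} {γ : ℝ}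
    (hS : ∀ z w, Tendsto (fun k => S k z w) atTop (𝓝 (Sinf z w))) (h : ∀ k, Coercive (S k) γ) : Coercive Sinf γ :=
  fun v => ge_of_tendsto (tendsto_dotProduct_mulVec hS v) (Eventually.of_forall fun k => h k v)

omit [DecidableEq n] in
/-- Uniform entry bounds are closed under limits. [folklore] -/
theorem abs_lim_le_of_abs_le {u : ℕ → ℝ} {ℓ b : ℝ} (hu : Tendsto u atTop (𝓝 ℓ)) (h : ∀ᶠ k in atTop, |u k| ≤ b) : |ℓ| ≤ b :=
  le_of_tendsto hu.abs h

/-- **(H1) + (H2) ⇒ the (4.34)-DECAY OF EVERY `(D k + B)⁻¹`**: `|(D k + B)⁻¹(x,y)| ≤ (γ − ρ − ρ_B)⁻¹·e^{−κd(x,y)}` at every level (the finite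
Combes–Thomas lemma `King1986.covOp_decay` at the endpoint `s = 1`). [cite: King1986, (4.34) p.674] -/
theorem inv_entry_decay_of_leaves {D : ℕ → Matrix n n ℝ} {B : Matrix n n ℝ} {d : n → n → ℝ} {γ κ ρ ρB : ℝ}
    (hd : IsPseudoMetric d) (hγ : ρ + ρB < γ) (hκ : 0 ≤ κ) (h1 : UniformCoercive D B γ) (h2 : UniformCTBound D B d κ ρ ρB)
    (k : ℕ) (i j : n) : |(D k + B)⁻¹ i j| ≤ (γ - (ρ + ρB))⁻¹ * Real.exp (-(κ * d i j)) := by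
  obtain ⟨hr, hc, hrB, hcB⟩ := h2
  have h := covOp_decay (D k) (D k) B d hγ hκ (h1 k) (h1 k) hd.symm hd.zero hd.tri (hr k) (hr k) hrB (hc k) (hc k) hcB
    zero_le_one le_rfl i j
  rwa [covOp_one] at h

/-- **THE CONTINUUM-LIMIT PACKAGE OF THE FIVE LEAVES (kernel-checked).**  For a tower `D k` and block term `B` on a finite index set with pseudo-metric
`d`, the five leaves of the socket with `0 ≤ r < 1`, `0 < γ`, `ρ + ρ_B < γ` give limit objects `D^∞`, `C^∞` with: `D k → D^∞` entrywise (tail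
`εr^k∕(1−r)`); `Coercive (D^∞ + B) γ`; `(D^∞ + B)·C^∞ = 1` and `C^∞ = (D^∞ + B)⁻¹`; `(D k + B)⁻¹ → C^∞` entrywise; `|C^∞(x,y)| ≤ (γ−ρ−ρ_B)⁻¹e^{−κd(x,y)}`;
and the decay-keeping tail `|(D k + B)⁻¹(x,y) − C^∞(x,y)| ≤ C_K·e^{−(κ∕2)d(x,y)}·(√r)^k∕(1 − √r)`, `C_K = √(2C₁ε)(γ−ρ−ρ_B)⁻²V²` (the assembly's).
This is King's §4 conclusion for the linear layer, abstracted: the pay-off of part 3's checklist for ANY tower inhabiting it.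
[cite: King1986, §4 pp.674–676 (Lemma 4.3 (4.18), (4.33)–(4.34), Lemma 4.5 (4.38))] -/
theorem continuumLimit_of_leaves (D : ℕ → Matrix n n ℝ) (B : Matrix n n ℝ) (d : n → n → ℝ)
    {γ κ ρ ρB ε C₁ V r : ℝ} (hd : IsPseudoMetric d) (hγ : ρ + ρB < γ) (hγ0 : 0 < γ) (hκ : 0 ≤ κ) (hε : 0 ≤ ε) (hr : 0 ≤ r) (hr1 : r < 1)
    (h1 : UniformCoercive D B γ) (h2 : UniformCTBound D B d κ ρ ρB) (h2' : UniformKernelDecay D d C₁ κ)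
    (h3 : EffectiveOperatorSupRate D ε r) (h4 : VolumeSum d κ V) :
    ∃ Dinf Cinf : Matrix n n ℝ,
      (∀ z w, Tendsto (fun k => D k z w) atTop (𝓝 (Dinf z w))) ∧
      (∀ k z w, |D k z w - Dinf z w| ≤ ε * r ^ k / (1 - r)) ∧
      Coercive (Dinf + B) γ ∧ (Dinf + B) * Cinf = 1 ∧ Cinf = (Dinf + B)⁻¹ ∧
      (∀ x y, Tendsto (fun k => (D k + B)⁻¹ x y) atTop (𝓝 (Cinf x y))) ∧
      (∀ x y, |Cinf x y| ≤ (γ - (ρ + ρB))⁻¹ * Real.exp (-(κ * d x y))) ∧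
      (∀ k x y, |(D k + B)⁻¹ x y - Cinf x y|
        ≤ Real.sqrt (ε * (2 * C₁)) * ((γ - (ρ + ρB))⁻¹) ^ 2 * V ^ 2 * Real.exp (-(κ / 2 * d x y))
            * Real.sqrt r ^ k / (1 - Real.sqrt r)) := by
  obtain ⟨Dinf, hD⟩ := tower_limit hr1 h3
  have hroot := covarianceTowerRate_of_leaves D B d hd hγ hκ hε hr h1 h2 h2' h3 h4
  have hs1 : Real.sqrt r < 1 := by simpa only [Real.sqrt_one] using Real.sqrt_lt_sqrt hr hr1
  choose ℓ hℓ using covariance_entry_limit_decay hs1 hroot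
  have hC : ∀ x y, Tendsto (fun k => (D k + B)⁻¹ x y) atTop (𝓝 (Matrix.of ℓ x y)) := fun x y => by
    rw [Matrix.of_apply]; exact (hℓ x y).1
  have hA : ∀ z w, Tendsto (fun k => (D k + B) z w) atTop (𝓝 ((Dinf + B) z w)) := fun z w => by
    simp only [Matrix.add_apply]; exact (hD z w).1.add tendsto_const_nhds
  have hone : (Dinf + B) * Matrix.of ℓ = 1 :=
    limit_mul_eq_one hA hC fun k =>
      Matrix.mul_nonsing_inv _ ((Matrix.isUnit_iff_isUnit_det _).mp (isUnit_of_coercive hγ0 (h1 k)))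
  refine ⟨Dinf, Matrix.of ℓ, fun z w => (hD z w).1, fun k z w => (hD z w).2 k, coercive_of_tendsto hA fun k => h1 k, hone,
    (Matrix.inv_eq_right_inv hone).symm, hC, fun x y => ?_, fun k x y => ?_⟩
  · exact abs_lim_le_of_abs_le (hC x y) (Eventually.of_forall fun k => inv_entry_decay_of_leaves hd hγ hκ h1 h2 k x y)
  · rw [Matrix.of_apply]
    exact (hℓ x y).2 k

end Generic

/-! ## §2 King's model by name: `Δ^{(∞)}` and `C^{(∞)}` on every torus -/

section KingTower

variable {dd : ℕ} {a m2 : ℝ} {L : ℕ} [NeZero L] {M : Fin dd → ℕ} [∀ μ, NeZero (M μ)]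

/-- **`Δ^{(∞)}` — THE CONTINUUM-LIMIT EFFECTIVE LAPLACIAN of King's `A = 0` model on the unit lattice `Π_μ ℤ∕(LM_μ)`**: the entrywise limit
`lim_k Δ^{(k)}(x, y)` of part 3's `kingLevel` (Mathlib's `limUnder atTop`; it IS the limit by `kingLevel_tendsto`). [cite: King1986, Lemma 4.3 (4.18) p.672, §4 p.675] -/
def kingLevelLim (a m2 : ℝ) (L : ℕ) [NeZero L] (M : Fin dd → ℕ) [∀ μ, NeZero (M μ)] : Matrix (Tor (fine L M)) (Tor (fine L M)) ℝ :=
  Matrix.of fun x y => limUnder atTop fun k => kingLevel a m2 L M k x y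

/-- **THE ℕ-TOWER CONVERGES TO `Δ^{(∞)}` ENTRYWISE**, tail `θ̄a·(L⁻²)^k∕(1 − L⁻²)` at every `k` (leaf (H3) `effectiveOperatorSupRate_kingTower` +
`tower_entry_limit`). [cite: King1986, Lemma 4.3 (4.18) p.672] -/
theorem kingTower_tendsto (ha : 0 < a) (hm : 0 < m2) (hL : 2 ≤ L) (x y : Tor (fine L M)) :
    Tendsto (fun k => kingTower a m2 L M k x y) atTop (𝓝 (kingLevelLim a m2 L M x y)) ∧
      ∀ k, |kingTower a m2 L M k x y - kingLevelLim a m2 L M x y| ≤ thetaBar a L * a * (((L : ℝ) ^ 2)⁻¹) ^ k / (1 - ((L : ℝ) ^ 2)⁻¹) := by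
  have hLr : (1 : ℝ) < L := by exact_mod_cast hL
  have hr1 : ((L : ℝ) ^ 2)⁻¹ < 1 := inv_lt_one_of_one_lt₀ (by nlinarith)
  obtain ⟨ℓ, h1, h2⟩ := tower_entry_limit hr1 (effectiveOperatorSupRate_kingTower (M := M) ha hm hL) x y
  have h1' : Tendsto (fun k => kingLevel a m2 L M k x y) atTop (𝓝 ℓ) := by
    refine h1.congr' ?_
    filter_upwards [eventually_ge_atTop 1] with k hk
    rw [kingTower_of_one_le hk]
  have hlim : kingLevelLim a m2 L M x y = ℓ := by simp only [kingLevelLim, Matrix.of_apply]; exact h1'.limUnder_eq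
  exact hlim ▸ ⟨h1, h2⟩

/-- **`Δ^{(k)}(x, y) → Δ^{(∞)}(x, y)`** with the tail `|Δ^{(k)}(x, y) − Δ^{(∞)}(x, y)| ≤ θ̄a·L^{−2k}∕(1 − L⁻²)` for `k ≥ 1`, on every torus (`L ≥ 2`,
`a, m² > 0`). [cite: King1986, Lemma 4.3 (4.18) p.672, §4 p.675] -/
theorem kingLevel_tendsto (ha : 0 < a) (hm : 0 < m2) (hL : 2 ≤ L) (x y : Tor (fine L M)) :
    Tendsto (fun k => kingLevel a m2 L M k x y) atTop (𝓝 (kingLevelLim a m2 L M x y)) ∧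
      ∀ k, 1 ≤ k → |kingLevel a m2 L M k x y - kingLevelLim a m2 L M x y| ≤ thetaBar a L * a * (((L : ℝ) ^ 2)⁻¹) ^ k / (1 - ((L : ℝ) ^ 2)⁻¹) := by
  obtain ⟨h1, h2⟩ := kingTower_tendsto (M := M) ha hm hL x y
  refine ⟨h1.congr' ?_, fun k hk => ?_⟩
  · filter_upwards [eventually_ge_atTop 1] with k hk
    rw [kingTower_of_one_le hk]
  · have h := h2 k
    rwa [kingTower_of_one_le hk] at h

/-- `Δ^{(∞)}` is symmetric (every `Δ^{(k)}` is: `effLaplacian_symm`). [folklore] -/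
theorem kingLevelLim_symm (x y : Tor (fine L M)) : kingLevelLim a m2 L M y x = kingLevelLim a m2 L M x y := by
  simp only [kingLevelLim, Matrix.of_apply]
  exact congrArg _ (funext fun k => effLaplacian_symm _ _ _ _ _ x y)

/-- The block term `aL⁻²Q*Q` is symmetric. [folklore] -/
theorem kingBlock_symm (x y : Tor (fine L M)) : kingBlock a L M y x = kingBlock a L M x y := by
  simp only [kingBlock, Matrix.smul_apply, blockProj]
  by_cases h : blockOf L M x = blockOf L M y
  · rw [if_pos h, if_pos h.symm]
  · rw [if_neg h, if_neg (Ne.symm h)]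

/-- The levels-plus-block converge entrywise to `Δ^{(∞)} + aL⁻²Q*Q`. [folklore] -/
theorem kingTower_add_block_tendsto (ha : 0 < a) (hm : 0 < m2) (hL : 2 ≤ L) (z w : Tor (fine L M)) :
    Tendsto (fun k => (kingTower a m2 L M k + kingBlock a L M) z w) atTop (𝓝 ((kingLevelLim a m2 L M + kingBlock a L M) z w)) := by
  simp only [Matrix.add_apply]
  exact (kingTower_tendsto ha hm hL z w).1.add tendsto_const_nhds

/-- **(4.33) FOR THE LIMIT THEORY**: `Δ^{(∞)} + aL⁻²Q*Q ≥ γ₀ = gam0L(a, L, d)` — uniform coercivity survives `k → ∞` (`coercive_of_tendsto` on leaf (H1)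
`uniformCoercive_kingTower`). [cite: King1986, (4.33) p.674] -/
theorem coercive_kingLevelLim_add_block (ha : 0 < a) (hm : 0 < m2) (hL : 2 ≤ L) :
    Coercive (kingLevelLim a m2 L M + kingBlock a L M) (gam0L dd a L) :=
  coercive_of_tendsto (S := fun k => kingTower a m2 L M k + kingBlock a L M) (kingTower_add_block_tendsto ha hm hL)
    (uniformCoercive_kingTower ha hm hL)

/-- **`Δ^{(∞)} + aL⁻²Q*Q` IS POSITIVE DEFINITE** (symmetric and coercive with `γ₀ > 0`) — the quadratic form of a non-degenerate Gaussian.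
[cite: King1986, (4.33) p.674] -/
theorem posDef_kingLevelLim_add_block (ha : 0 < a) (hm : 0 < m2) (hL : 2 ≤ L) : (kingLevelLim a m2 L M + kingBlock a L M).PosDef :=
  posDef_of_coercive_symm (Matrix.IsSymm.ext fun i j => by rw [Matrix.add_apply, Matrix.add_apply, kingLevelLim_symm, kingBlock_symm])
    (gam0L_pos (d := dd) ha hL) (coercive_kingLevelLim_add_block ha hm hL)

end KingTower

section KingCov

variable {d : ℕ} {a m2 : ℝ} {L : ℕ} [NeZero L]

/-- **`C^{(∞)}` — THE CONTINUUM-LIMIT FLUCTUATION COVARIANCE of King's `A = 0` model on the unit lattice of the torus `Π_μ ℤ∕(LM_μ)` (`μ < d + 1`)**: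
the entrywise limit `lim_k C^{(k)}(x, y)` of part 1's `kingCov … (L^k) k` (`limUnder atTop`; it IS the limit by `kingCov_tendsto_kingCovLim`, and it is
`(Δ^{(∞)} + aL⁻²Q*Q)⁻¹` by `kingCovLim_eq_inv`). [cite: King1986, Lemma 4.5 (4.38) p.674, §4 pp.675–676] -/
def kingCovLim (a m2 : ℝ) (L : ℕ) [NeZero L] (M : Fin (d + 1) → ℕ) [∀ μ, NeZero (M μ)] : Matrix (Tor (fine L M)) (Tor (fine L M)) ℝ :=
  Matrix.of fun x y => limUnder atTop fun k => kingCov L M a m2 (L ^ k) k x y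

variable (M : Fin (d + 1) → ℕ) [∀ μ, NeZero (M μ)]

/-- For `k ≥ 1`, part 1's `C^{(k)}` is the inverse of level `k` of part 3's tower plus the block term. [folklore] -/
theorem kingCov_eq_towerInv {k : ℕ} (hk : 1 ≤ k) : kingCov L M a m2 (L ^ k) k = (kingTower a m2 L M k + kingBlock a L M)⁻¹ := by
  rw [kingTower_of_one_le hk]; rfl

/-- **`C^{(k)}(x, y) → C^{(∞)}(x, y)`** on every torus (`L ≥ 2`, `a, m² > 0`). [cite: King1986, Lemma 4.5 (4.38) p.674, §4 pp.675–676] -/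
theorem kingCov_tendsto_kingCovLim (ha : 0 < a) (hm : 0 < m2) (hL : 2 ≤ L) (x y : Tor (fine L M)) :
    Tendsto (fun k => kingCov L M a m2 (L ^ k) k x y) atTop (𝓝 (kingCovLim a m2 L M x y)) := by
  obtain ⟨ℓ, h1, -⟩ := kingCov_tendsto ha hm hL M x y
  have hlim : kingCovLim a m2 L M x y = ℓ := by simp only [kingCovLim, Matrix.of_apply]; exact h1.limUnder_eq
  exact hlim ▸ h1

/-- The tower's inverses converge entrywise to `C^{(∞)}` (all `k`; level 0 of the ℕ-tower is level 1). [folklore] -/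
theorem towerInv_tendsto_kingCovLim (ha : 0 < a) (hm : 0 < m2) (hL : 2 ≤ L) (x y : Tor (fine L M)) :
    Tendsto (fun k => (kingTower a m2 L M k + kingBlock a L M)⁻¹ x y) atTop (𝓝 (kingCovLim a m2 L M x y)) := by
  refine (kingCov_tendsto_kingCovLim M ha hm hL x y).congr' ?_
  filter_upwards [eventually_ge_atTop 1] with k hk
  rw [kingCov_eq_towerInv M hk]

/-- **`(Δ^{(∞)} + aL⁻²Q*Q)·C^{(∞)} = 1`** — the identity `(Δ^{(k)} + aL⁻²Q*Q)·C^{(k)} = 1` passed to the limit (`limit_mul_eq_one`).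
[cite: King1986, (2.16) p.653, §4 p.675] -/
theorem kingLevelLim_add_block_mul_kingCovLim (ha : 0 < a) (hm : 0 < m2) (hL : 2 ≤ L) :
    (kingLevelLim a m2 L M + kingBlock a L M) * kingCovLim a m2 L M = 1 :=
  limit_mul_eq_one (A := fun k => kingTower a m2 L M k + kingBlock a L M) (C := fun k => (kingTower a m2 L M k + kingBlock a L M)⁻¹)
    (kingTower_add_block_tendsto ha hm hL) (towerInv_tendsto_kingCovLim M ha hm hL) fun k =>
      Matrix.mul_nonsing_inv _ ((Matrix.isUnit_iff_isUnit_det _).mp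
        (isUnit_of_coercive (gam0L_pos (d := d + 1) ha hL) (uniformCoercive_kingTower ha hm hL k)))

/-- **`C^{(∞)} = (Δ^{(∞)} + aL⁻²Q*Q)⁻¹` — THE COVARIANCE OF THE CONTINUUM-LIMIT EFFECTIVE THEORY, IDENTIFIED** (King's §4: the limit theory
exists as a Gaussian unit-lattice theory, not merely as a table of limiting numbers). [cite: King1986, §4 pp.675–676 with Lemma 4.3 (4.18), Lemma 4.5 (4.38)] -/
theorem kingCovLim_eq_inv (ha : 0 < a) (hm : 0 < m2) (hL : 2 ≤ L) :
    kingCovLim a m2 L M = (kingLevelLim a m2 L M + kingBlock a L M)⁻¹ :=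
  (Matrix.inv_eq_right_inv (kingLevelLim_add_block_mul_kingCovLim M ha hm hL)).symm

/-- … and `C^{(∞)}·(Δ^{(∞)} + aL⁻²Q*Q) = 1`. [folklore] -/
theorem kingCovLim_mul_kingLevelLim_add_block (ha : 0 < a) (hm : 0 < m2) (hL : 2 ≤ L) :
    kingCovLim a m2 L M * (kingLevelLim a m2 L M + kingBlock a L M) = 1 :=
  mul_eq_one_comm.mp (kingLevelLim_add_block_mul_kingCovLim M ha hm hL)

/-- **`C^{(∞)}` IS POSITIVE DEFINITE** — a bona fide non-degenerate Gaussian covariance (`Matrix.PosDef.inv`). [cite: King1986, (4.33) p.674, §4 p.675] -/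
theorem posDef_kingCovLim (ha : 0 < a) (hm : 0 < m2) (hL : 2 ≤ L) : (kingCovLim a m2 L M).PosDef := by
  rw [kingCovLim_eq_inv M ha hm hL]
  exact (posDef_kingLevelLim_add_block ha hm hL).inv

/-- `C^{(∞)}` is symmetric. [folklore] -/
theorem kingCovLim_symm (ha : 0 < a) (hm : 0 < m2) (hL : 2 ≤ L) (x y : Tor (fine L M)) :
    kingCovLim a m2 L M y x = kingCovLim a m2 L M x y := by
  have h := (posDef_kingCovLim M ha hm hL).isHermitian
  have h1 := congrFun (congrFun h x) y
  rwa [Matrix.conjTranspose_apply, star_trivial] at h1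

/-- **(4.34) FOR EVERY `C^{(k)}`**: `|C^{(k)}(x, y)| ≤ (γ₀ − ρ − ρ_B)⁻¹·e^{−κ′|x−y|_T}` for `k ≥ 1` (leaves (H1)+(H2) through `inv_entry_decay_of_leaves`;
`κ′ = kapCT`, `ρ = kingRho`, `ρ_B = kingRhoB`). [cite: King1986, (4.34) p.674] -/
theorem kingCov_abs_le (ha : 0 < a) (hm : 0 < m2) (hL : 2 ≤ L) {k : ℕ} (hk : 1 ≤ k) (x y : Tor (fine L M)) :
    |kingCov L M a m2 (L ^ k) k x y|
      ≤ (gam0L (d + 1) a L - (kingRho (d + 1) a L + kingRhoB (d + 1) a L))⁻¹ * Real.exp (-(kapCT (d + 1) a L * tdistT (fine L M) x y)) := by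
  rw [kingCov_eq_towerInv M hk]
  exact inv_entry_decay_of_leaves (isPseudoMetric_tdistT (fine L M)) (kingRho_add_lt_gam0L (dd := d + 1) ha hL)
    (kapCT_pos_le (d := d + 1) ha hL).1.le (uniformCoercive_kingTower ha hm hL) (uniformCTBound_kingTower ha hm hL) k x y

/-- **(4.34) FOR THE LIMIT**: `|C^{(∞)}(x, y)| ≤ (γ₀ − ρ − ρ_B)⁻¹·e^{−κ′|x−y|_T}` — the continuum-limit covariance DECAYS EXPONENTIALLY on the unit
lattice, uniformly in the torus. [cite: King1986, (4.34) p.674, §4 p.675] -/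
theorem kingCovLim_abs_le (ha : 0 < a) (hm : 0 < m2) (hL : 2 ≤ L) (x y : Tor (fine L M)) :
    |kingCovLim a m2 L M x y|
      ≤ (gam0L (d + 1) a L - (kingRho (d + 1) a L + kingRhoB (d + 1) a L))⁻¹ * Real.exp (-(kapCT (d + 1) a L * tdistT (fine L M) x y)) :=
  abs_lim_le_of_abs_le (towerInv_tendsto_kingCovLim M ha hm hL x y) (Eventually.of_forall fun k =>
    inv_entry_decay_of_leaves (isPseudoMetric_tdistT (fine L M)) (kingRho_add_lt_gam0L (dd := d + 1) ha hL)
      (kapCT_pos_le (d := d + 1) ha hL).1.le (uniformCoercive_kingTower ha hm hL) (uniformCTBound_kingTower ha hm hL) k x y)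

/-- The coercivity bound on the limit's entries: `|C^{(∞)}(x, y)| ≤ γ₀⁻¹`. [cite: King1986, (4.33) p.674] -/
theorem kingCovLim_abs_le_inv_gam0L (ha : 0 < a) (hm : 0 < m2) (hL : 2 ≤ L) (x y : Tor (fine L M)) :
    |kingCovLim a m2 L M x y| ≤ (gam0L (d + 1) a L)⁻¹ := by
  rw [kingCovLim_eq_inv M ha hm hL]
  exact inv_entry_le_of_coercive (gam0L_pos (d := d + 1) ha hL) (coercive_kingLevelLim_add_block ha hm hL) x y

/-- **KING'S (4.38) AT `n = ∞`, WITH ITS DECAY**: for `k ≥ 1` and all sites of every torus,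
`|C^{(k)}(x, y) − C^{(∞)}(x, y)| ≤ K₄₅·L^{−k}·e^{−δ₄₅|x−y|_T}` — straight from the n-UNIFORM printed theorem `king_lemma45_torus` by letting `n → ∞`
(no `(1 − L⁻¹)⁻¹` factor: the printed constant is already uniform in `n`). THIS is the use of Lemma 4.5 on p. 675. [cite: King1986, Lemma 4.5 (4.38) p.674, §4 p.675] -/
theorem kingCov_sub_kingCovLim_le (ha : 0 < a) (hm : 0 < m2) (hL : 2 ≤ L) {k : ℕ} (hk : 1 ≤ k) (x y : Tor (fine L M)) :
    |kingCov L M a m2 (L ^ k) k x y - kingCovLim a m2 L M x y|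
      ≤ K45 (d + 1) a L * ((L : ℝ) ^ k)⁻¹ * Real.exp (-(delta45 (d + 1) a L * tdistT (fine L M) x y)) := by
  have hg : Tendsto (fun n => kingCov L M a m2 (L ^ n * L ^ k) (k + n) x y) atTop (𝓝 (kingCovLim a m2 L M x y)) := by
    have h2 := (kingCov_tendsto_kingCovLim M ha hm hL x y).comp (tendsto_add_atTop_nat k)
    refine h2.congr fun n => ?_
    show kingCov L M a m2 (L ^ (n + k)) (n + k) x y = _
    rw [kingCov_congrN M (show L ^ (n + k) = L ^ n * L ^ k from pow_add L n k), Nat.add_comm n k]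
  have habs : Tendsto (fun n => |kingCov L M a m2 (L ^ k) k x y - kingCov L M a m2 (L ^ n * L ^ k) (k + n) x y|) atTop
      (𝓝 |kingCov L M a m2 (L ^ k) k x y - kingCovLim a m2 L M x y|) :=
    (tendsto_const_nhds.sub hg).abs
  exact le_of_tendsto habs (by filter_upwards [eventually_ge_atTop 1] with n hn; exact king_lemma45_torus (d := d + 1) ha hm hL hk hn M x y)

/-- The socket's decay-free tail for the named limit (part 4's `kingCov_tendsto`, whose `ℓ` IS `C^{(∞)}(x, y)`): `|C^{(k)}(x, y) − C^{(∞)}(x, y)| ≤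
C_K·L^{−k}∕(1 − L⁻¹)`, `k ≥ 1`. [cite: King1986, Lemma 4.5 (4.38) p.674] -/
theorem kingCov_sub_kingCovLim_le_socket (ha : 0 < a) (hm : 0 < m2) (hL : 2 ≤ L) {k : ℕ} (hk : 1 ≤ k) (x y : Tor (fine L M)) :
    |kingCov L M a m2 (L ^ k) k x y - kingCovLim a m2 L M x y| ≤ kingC (d + 1) a L * ((L : ℝ)⁻¹) ^ k / (1 - (L : ℝ)⁻¹) := by
  obtain ⟨ℓ, h1, h2⟩ := kingCov_tendsto ha hm hL M x y
  exact tendsto_nhds_unique h1 (kingCov_tendsto_kingCovLim M ha hm hL x y) ▸ h2 k hk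

/-- **THE CONTINUUM LIMIT OF KING'S UNIT-LATTICE EFFECTIVE THEORY, AT ONCE** (every torus `Π_μ ℤ∕(LM_μ)`, `μ < d + 1`, `L ≥ 2`, `a, m² > 0`): the
covariances `C^{(k)}` converge AS MATRICES to `C^{(∞)} = (Δ^{(∞)} + aL⁻²Q*Q)⁻¹`, which is positive definite and exponentially decaying, at the printed rate
`K₄₅L^{−k}e^{−δ₄₅|x−y|_T}`.  HONEST SCOPE: King's A = 0 scalar model at fixed unit torus; NOT Bałaban's carriers; count-neutral.
[cite: King1986, §4 pp.670–676: Lemma 4.3 (4.18) p.672, (4.33)–(4.34) p.674, Lemma 4.5 (4.38) p.674] -/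
theorem king_continuumLimit (ha : 0 < a) (hm : 0 < m2) (hL : 2 ≤ L) :
    Tendsto (fun k => kingCov L M a m2 (L ^ k) k) atTop (𝓝 (kingCovLim a m2 L M)) ∧
      kingCovLim a m2 L M = (kingLevelLim a m2 L M + kingBlock a L M)⁻¹ ∧ (kingCovLim a m2 L M).PosDef ∧
      (∀ x y, |kingCovLim a m2 L M x y|
        ≤ (gam0L (d + 1) a L - (kingRho (d + 1) a L + kingRhoB (d + 1) a L))⁻¹ * Real.exp (-(kapCT (d + 1) a L * tdistT (fine L M) x y))) ∧
      ∀ k, 1 ≤ k → ∀ x y, |kingCov L M a m2 (L ^ k) k x y - kingCovLim a m2 L M x y|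
        ≤ K45 (d + 1) a L * ((L : ℝ) ^ k)⁻¹ * Real.exp (-(delta45 (d + 1) a L * tdistT (fine L M) x y)) :=
  ⟨tendsto_pi_nhds.mpr fun x => tendsto_pi_nhds.mpr fun y => kingCov_tendsto_kingCovLim M ha hm hL x y, kingCovLim_eq_inv M ha hm hL,
    posDef_kingCovLim M ha hm hL, kingCovLim_abs_le M ha hm hL, fun _ hk x y => kingCov_sub_kingCovLim_le M ha hm hL hk x y⟩

/-- **THE FOUR-TORUS INSTANCE** (`d + 1 = 4`, the dimension of the T⁴ programme). [cite: King1986, §4 pp.670–676] -/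
theorem king_continuumLimit_dim4 (ha : 0 < a) (hm : 0 < m2) (hL : 2 ≤ L) (M : Fin 4 → ℕ) [∀ μ, NeZero (M μ)] :
    Tendsto (fun k => kingCov L M a m2 (L ^ k) k) atTop (𝓝 (kingCovLim a m2 L M)) ∧
      kingCovLim a m2 L M = (kingLevelLim a m2 L M + kingBlock a L M)⁻¹ ∧ (kingCovLim a m2 L M).PosDef ∧
      (∀ x y, |kingCovLim a m2 L M x y|
        ≤ (gam0L 4 a L - (kingRho 4 a L + kingRhoB 4 a L))⁻¹ * Real.exp (-(kapCT 4 a L * tdistT (fine L M) x y))) ∧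
      ∀ k, 1 ≤ k → ∀ x y, |kingCov L M a m2 (L ^ k) k x y - kingCovLim a m2 L M x y|
        ≤ K45 4 a L * ((L : ℝ) ^ k)⁻¹ * Real.exp (-(delta45 4 a L * tdistT (fine L M) x y)) :=
  king_continuumLimit (d := 3) M ha hm hL

end KingCov

/-! ## ADDENDUM v1.1 (append-only, same seat): the limit effective operator is exponentially LOCAL ((H2′) at `k = ∞`) -/
section LimitDecay
open Literature.MathematicalPhysics.QuantumFieldTheory.King1986.Torus (CDelU aminL)
variable {n : Type*} {dd : ℕ} {a m2 : ℝ} {L : ℕ} [NeZero L] {M : Fin dd → ℕ} [∀ μ, NeZero (M μ)]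
/-- **(H2′) passes to the limit**: a uniformly decaying tower with entrywise limit `D^∞` has `|D^∞(z, w)| ≤ C₁e^{−2κd(z,w)}`. [folklore] -/
theorem tower_limit_abs_le {D : ℕ → Matrix n n ℝ} {Dinf : Matrix n n ℝ} {d : n → n → ℝ} {C₁ κ : ℝ}
    (hD : ∀ z w, Tendsto (fun k => D k z w) atTop (𝓝 (Dinf z w))) (h2' : UniformKernelDecay D d C₁ κ) (z w : n) :
    |Dinf z w| ≤ C₁ * Real.exp (-(2 * κ * d z w)) := abs_lim_le_of_abs_le (hD z w) (Eventually.of_forall fun k => h2' k z w)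
/-- **THE CONTINUUM-LIMIT EFFECTIVE LAPLACIAN IS EXPONENTIALLY LOCAL**: `|Δ^{(∞)}(z, w)| ≤ C_U·e^{−2κ′|z−w|_T}` on every torus (King's uniform
decay of `Δ^{(k)}`, Thm 3.3 (3.6) ∕ (4.34), at `k = ∞`; `C_U = CDelU`, `κ′ = kapCT`). [cite: King1986, Thm 3.3 (3.6) p.656, (4.34) p.674, §4 p.675] -/
theorem kingLevelLim_abs_le (ha : 0 < a) (hm : 0 < m2) (hL : 2 ≤ L) (z w : Tor (fine L M)) :
    |kingLevelLim a m2 L M z w| ≤ CDelU dd a (aminL a L) * Real.exp (-(2 * kapCT dd a L * tdistT (fine L M) z w)) :=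
  tower_limit_abs_le (fun z w => (kingTower_tendsto ha hm hL z w).1) (uniformKernelDecay_kingTower ha hm hL) z w
end LimitDecay

end Summit.QuantumFields.YangMills.BalabanUVNodes.N15.KingModel

end
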